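import Summits.QuantumFields.YangMills.Theorems.FluctuationComparisonRegPrIntLS2BetaSignedCombKill
import HarnessLib

/-!
# S2β · (T)-chain ∕ DET-REP (B) — COMB CONNECTIVITY, ADDITIVE FORM: a function on the fine sites that is invariant along every bond of the `k`-fold comb set
# equals its value at the `k`-block centre; hence an infinitesimal pure gauge vanishing at the centres and killed on the comb is zero

Crux `stmt-QuantumFields-20520` (`…Theses.UnitScaleTilt.FluctuationComparisonRegPrIntL`), LINE g18-1 S2β; cell `ym3-torus` (HUMAN RULING D-0037 — rung R3: continuum `SU(2)`
Yang–Mills on `T³`; NOT `d = 4`, NOT infinite volume, NOT a mass gap, NOT Clay); width seat `ym3-torus-px13` g19; definition-free helper (`--kind proof --supports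
stmt-QuantumFields-20520 --as helper`, NOT a proof of the crux and NOT of any registered stub).  Theorems only: 0 `def`, 0 `instance`, 0 `notation`, 0 `sorry`; default
heartbeats; pure lattice combinatorics over ✓`…S2BetaSignedCombKill` §3 (block arithmetic) — any `Params`, any `k ≤ m + K`, values in ANY type.

WHY.  The (T)-chain's Hessian letter at the flat datum (px16 g17 ✓`…S2BetaFlatSecondVariationAlongCurve.hessPos_flat_of_transversal`, px21 g18 (T3) `hH`) displays ONE
kinematic row `hT`: «an infinitesimal pure gauge `b ↦ φ b.tgt − φ b.src` with `φ = 0` at the `(K−J)`-fold centres that is tangent to the chart of record at `0` is `0`».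
By the tube of record's rows (D0) «`σ y = U₀` on `combSet (K−J) ∪ pivots`» and the window chart's `hoffT` «`c.Φ (V, z) b = z b` off the pivots», the tangent
`D(c.Φ (V, σ ·))(0) y` VANISHES on every comb bond, so `φ b.tgt = φ b.src` for every `b ∈ combSet (K−J)` — and THIS FILE is the lattice lemma that then forces
`φ ≡ 0`: every fine site is joined to the centre `rootOf k x` of its `k`-block by a path of `combSet k` bonds (the signed comb of ✓`…S2BetaSignedComb.combTransporter`:
axes in the order `0, 1, …, d−1`, offsets `≤ (Lᵏ−1)∕2`, no wrap-around), along which a comb-invariant function is constant.  The multiplicative cousin for gauge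
TRANSFORMATIONS is ✓`UnitScaleTiltProp7AxialGauge.eq_one_of_axialGauge`; the additive ∕ value-in-any-type form was not in the tree.

WHAT.
* §1 `site_shift_update_eq`, `blockIter_update_rootOf_add_eq`, `rootOf_update_rootOf_add_eq` — moving ONE coordinate of `x` to `(rootOf k x)_μ + t`, `|t| ≤ (Lᵏ−1)∕2`, stays in the
  `k`-block of `x` (✓`val_rootOf_add`), so the root is unchanged; `update_mem_combSet` — the bond from offset `t` to `t + 1` in direction `μ` is a comb bond once the
  coordinates `ν > μ` of `x` sit at the root.
* §2 ★ `apply_update_eq_of_combInvariant` — walking coordinate `μ` from the root value to any admissible offset does not change a comb-invariant `φ` (two inductions on `ℕ`,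
  `t ≥ 0` and `t ≤ 0`).
* §3 ★★★ `apply_eq_apply_rootOf_of_combInvariant (hk : k ≤ P.m + P.K) (φ : Site P 0 → α) (hcomb : ∀ b ∈ combSet k, φ b.tgt = φ b.src) (x) : φ x = φ (rootOf k x)`
  (induction on the number of low coordinates allowed to differ from the root); ★★★ `eq_zero_of_combInvariant_of_rootOf` ∕ `…_of_embIter` — with `φ = 0` at the centres
  (`rootOf k x`, resp. `embIter k Y`), `φ = 0`: the additive `hT`-core.

HONEST SCOPE.  Lattice bookkeeping only; the tube∕chart rows that turn `hT` into «`φ` comb-invariant» and the injectivity of the frame `eV` on the free bonds are NOT here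
(FILE 2, on px16 g17's ∕ px21 g18's word); nothing of HESS∘, ISOL∘(δ), TUBE-REG∘, GAP♯∘, DET-REP (B), S2β or the crux 20520 is proved; rung R3 = `YM3TorusSU2` as filed —
SU(2) YM₃ on T³ at fixed lattice data, NOT d = 4, NOT infinite volume, NOT a mass gap, NOT Clay; the Yang–Mills mass gap is NOT proved.

References: T. Bałaban, CMP 109 (1987) 249–301 [Balaban1987RG1] ((0.1) pp. 251–252: blocks, centres, the standing range); CMP 102 (1985) 277–309 [Balaban1985Variational]
((19) p. 281: the comb axial gauge); CMP 99 (1985) 75–102 [Balaban1985RegularSpaces] ((1.19) p. 79 and the sentence after (1.20): one element per orbit).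
-/

set_option autoImplicit false

noncomputable section

open Function
open Literature.MathematicalPhysics.QuantumFieldTheory.Balaban1983to89
open Literature.MathematicalPhysics.QuantumFieldTheory.Balaban1983to89.T4RootedResidualGauge (rootOf)
open Literature.MathematicalPhysics.QuantumFieldTheory.Balaban1983to89.B15DeterminingSets (embIter)
open Literature.MathematicalPhysics.QuantumFieldTheory.Balaban1983to89.B14.Eq22Determines (blockIter)
open Literature.MathematicalPhysics.QuantumFieldTheory.Balaban1983to89.B15Eq177GaugeInvariance (blockIter_embIter)
open Summit.QuantumFields.YangMills.Theorems.FluctuationComparisonRegPrIntLS2BetaSignedCombKill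
  (combSet mem_combSet val_rootOf val_rootOf_le val_rootOf_add blockIter_eq_iff rootOf_eq_of_blockIter_eq)

namespace Summit.QuantumFields.YangMills.Theorems.FluctuationComparisonRegPrIntLS2BetaCombConnectivity

variable {P : Params} {k : ℕ} {α : Type*}

/-! ## §1 Moving one coordinate inside the block -/

/-- `(update x μ a).shift μ = update x μ (a + 1)` (bookkeeping). [folklore] -/
theorem site_shift_update_eq (x : Site P 0) (μ : Fin P.d) (a : ZMod (P.sitesPerDir 0)) :
    Site.shift (update x μ a) μ = update x μ (a + 1) := by
  unfold Site.shift
  rw [update_self, update_idem]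

/-- Moving coordinate `μ` of `x` to `(rootOf k x)_μ + t` with `|t| ≤ (Lᵏ−1)∕2` keeps the `k`-block (no wrap-around, ✓`val_rootOf_add`). [cite: Balaban1987RG1, (0.1) pp.251-252] -/
theorem blockIter_update_rootOf_add_eq (hk : k ≤ P.m + P.K) (x : Site P 0) (μ : Fin P.d) {t : ℤ}
    (ht₁ : -(((P.L ^ k - 1) / 2 : ℕ) : ℤ) ≤ t) (ht₂ : t ≤ (((P.L ^ k - 1) / 2 : ℕ) : ℤ)) :
    blockIter k (update x μ (rootOf k x μ + (t : ZMod (P.sitesPerDir 0)))) = blockIter k x := by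
  rw [blockIter_eq_iff hk]
  intro ν
  by_cases hν : ν = μ
  · subst hν
    rw [update_self]
    exact (val_rootOf_add hk x ν ht₁ ht₂).2
  · rw [update_of_ne hν]

/-- … hence keeps the root. [cite: Balaban1987RG1, (0.1) pp.251-252] -/
theorem rootOf_update_rootOf_add_eq (hk : k ≤ P.m + P.K) (x : Site P 0) (μ : Fin P.d) {t : ℤ}
    (ht₁ : -(((P.L ^ k - 1) / 2 : ℕ) : ℤ) ≤ t) (ht₂ : t ≤ (((P.L ^ k - 1) / 2 : ℕ) : ℤ)) :
    rootOf k (update x μ (rootOf k x μ + (t : ZMod (P.sitesPerDir 0)))) = rootOf k x :=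
  rootOf_eq_of_blockIter_eq (blockIter_update_rootOf_add_eq hk x μ ht₁ ht₂)

/-- **THE STEP BOND IS A COMB BOND**: if the coordinates `ν > μ` of `x` sit at the root, then for `t, t + 1` within `±(Lᵏ−1)∕2` the bond from
`update x μ ((rootOf k x)_μ + t)` in direction `μ` lies in `combSet k` (both ends in the block; later coordinates at the root of the source).
[cite: Balaban1985Variational, (19) p.281; Balaban1987RG1, (0.1) pp.251-252] -/
theorem update_mem_combSet (hk : k ≤ P.m + P.K) (x : Site P 0) (μ : Fin P.d) (hhi : ∀ ν, μ < ν → x ν = rootOf k x ν) {t : ℤ}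
    (ht₁ : -(((P.L ^ k - 1) / 2 : ℕ) : ℤ) ≤ t) (ht₂ : t + 1 ≤ (((P.L ^ k - 1) / 2 : ℕ) : ℤ)) :
    (⟨update x μ (rootOf k x μ + (t : ZMod (P.sitesPerDir 0))), μ⟩ : PBond P 0) ∈ (combSet k : Set (PBond P 0)) := by
  have ht₂' : t ≤ (((P.L ^ k - 1) / 2 : ℕ) : ℤ) := by linarith
  have ht₁' : -(((P.L ^ k - 1) / 2 : ℕ) : ℤ) ≤ t + 1 := by linarith
  rw [mem_combSet]
  refine ⟨?_, ?_⟩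
  · -- both ends in the block of `x`
    show blockIter k (update x μ (rootOf k x μ + (t : ZMod (P.sitesPerDir 0)))) =
      blockIter k (Site.shift (update x μ (rootOf k x μ + (t : ZMod (P.sitesPerDir 0)))) μ)
    rw [site_shift_update_eq, blockIter_update_rootOf_add_eq hk x μ ht₁ ht₂',
      show rootOf k x μ + (t : ZMod (P.sitesPerDir 0)) + 1 = rootOf k x μ + ((t + 1 : ℤ) : ZMod (P.sitesPerDir 0)) by push_cast; ring,
      blockIter_update_rootOf_add_eq hk x μ ht₁' ht₂]
  · -- later coordinates of the source sit at its root
    intro ν hν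
    show update x μ (rootOf k x μ + (t : ZMod (P.sitesPerDir 0))) ν = rootOf k (update x μ (rootOf k x μ + (t : ZMod (P.sitesPerDir 0)))) ν
    rw [rootOf_update_rootOf_add_eq hk x μ ht₁ ht₂', update_of_ne hν.ne']
    exact hhi ν hν

/-! ## §2 Walking one coordinate from the root value -/

/-- ★ **WALKING COORDINATE `μ` DOES NOT CHANGE A COMB-INVARIANT FUNCTION**: if `φ b.tgt = φ b.src` for every comb bond and the coordinates `ν > μ` of `x` sit at the root,
then `φ (update x μ ((rootOf k x)_μ + t)) = φ (update x μ (rootOf k x)_μ)` for every `|t| ≤ (Lᵏ−1)∕2`. [cite: Balaban1985Variational, (19) p.281] -/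
theorem apply_update_eq_of_combInvariant (hk : k ≤ P.m + P.K) (φ : Site P 0 → α)
    (hcomb : ∀ b : PBond P 0, b ∈ (combSet k : Set (PBond P 0)) → φ b.tgt = φ b.src)
    (x : Site P 0) (μ : Fin P.d) (hhi : ∀ ν, μ < ν → x ν = rootOf k x ν) {t : ℤ}
    (ht₁ : -(((P.L ^ k - 1) / 2 : ℕ) : ℤ) ≤ t) (ht₂ : t ≤ (((P.L ^ k - 1) / 2 : ℕ) : ℤ)) :
    φ (update x μ (rootOf k x μ + (t : ZMod (P.sitesPerDir 0)))) = φ (update x μ (rootOf k x μ)) := by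
  -- positive offsets
  have hpos : ∀ n : ℕ, (n : ℤ) ≤ (((P.L ^ k - 1) / 2 : ℕ) : ℤ) →
      φ (update x μ (rootOf k x μ + ((n : ℤ) : ZMod (P.sitesPerDir 0)))) = φ (update x μ (rootOf k x μ)) := by
    intro n
    induction n with
    | zero => intro _; simp
    | succ n ih =>
        intro hn
        have hn' : (n : ℤ) ≤ (((P.L ^ k - 1) / 2 : ℕ) : ℤ) := by push_cast at hn ⊢; omega
        have hb := hcomb _ (update_mem_combSet hk x μ hhi (t := n) (by omega) (by push_cast at hn ⊢; omega))
        -- `hb : φ tgt = φ src`, tgt = offset `n + 1`, src = offset `n`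
        rw [← ih hn']
        have htgt : (⟨update x μ (rootOf k x μ + ((n : ℤ) : ZMod (P.sitesPerDir 0))), μ⟩ : PBond P 0).tgt =
            update x μ (rootOf k x μ + (((n + 1 : ℕ) : ℤ) : ZMod (P.sitesPerDir 0))) := by
          show Site.shift (update x μ (rootOf k x μ + ((n : ℤ) : ZMod (P.sitesPerDir 0)))) μ = _
          rw [site_shift_update_eq]; push_cast; ring_nf
        rw [← htgt, hb]
  -- negative offsets
  have hneg : ∀ n : ℕ, -(((P.L ^ k - 1) / 2 : ℕ) : ℤ) ≤ -(n : ℤ) →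
      φ (update x μ (rootOf k x μ + ((-(n : ℤ) : ℤ) : ZMod (P.sitesPerDir 0)))) = φ (update x μ (rootOf k x μ)) := by
    intro n
    induction n with
    | zero => intro _; simp
    | succ n ih =>
        intro hn
        have hn' : -(((P.L ^ k - 1) / 2 : ℕ) : ℤ) ≤ -(n : ℤ) := by push_cast at hn ⊢; omega
        have hb := hcomb _ (update_mem_combSet hk x μ hhi (t := -((n + 1 : ℕ) : ℤ)) hn (by push_cast; omega))
        -- `hb : φ tgt = φ src`, tgt = offset `−n`, src = offset `−(n+1)`
        rw [← ih hn']
        have htgt : (⟨update x μ (rootOf k x μ + ((-((n + 1 : ℕ) : ℤ) : ℤ) : ZMod (P.sitesPerDir 0))), μ⟩ : PBond P 0).tgt =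
            update x μ (rootOf k x μ + ((-(n : ℤ) : ℤ) : ZMod (P.sitesPerDir 0))) := by
          show Site.shift (update x μ (rootOf k x μ + ((-((n + 1 : ℕ) : ℤ) : ℤ) : ZMod (P.sitesPerDir 0)))) μ = _
          rw [site_shift_update_eq]; push_cast; ring_nf
        rw [← htgt, hb]
  rcases le_or_gt 0 t with ht | ht
  · obtain ⟨n, rfl⟩ := Int.eq_ofNat_of_zero_le ht
    exact hpos n ht₂
  · obtain ⟨n, hn⟩ := Int.eq_ofNat_of_zero_le (show 0 ≤ -t by linarith)
    have htn : t = -(n : ℤ) := by linarith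
    subst htn
    exact hneg n ht₁

/-! ## §3 Comb connectivity -/

/-- ★★★ **COMB CONNECTIVITY**: a function on the fine sites with `φ b.tgt = φ b.src` for every bond of the `k`-fold comb set equals, at every site, its value at the centre of the
site's `k`-block: `φ x = φ (rootOf k x)` (the comb joins every site to its centre inside the block; induction on the number of low coordinates in which `x` may differ
from its root). [cite: Balaban1985Variational, (19) p.281; Balaban1985RegularSpaces, (1.19) p.79] -/
theorem apply_eq_apply_rootOf_of_combInvariant (hk : k ≤ P.m + P.K) (φ : Site P 0 → α)
    (hcomb : ∀ b : PBond P 0, b ∈ (combSet k : Set (PBond P 0)) → φ b.tgt = φ b.src) (x : Site P 0) :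
    φ x = φ (rootOf k x) := by
  -- `Q j`: every site whose coordinates of index `≥ j` sit at its root satisfies the claim
  suffices hQ : ∀ j : ℕ, ∀ z : Site P 0, (∀ ν : Fin P.d, j ≤ ν.val → z ν = rootOf k z ν) → φ z = φ (rootOf k z) by
    exact hQ P.d x (fun ν hν => absurd hν (not_le.mpr ν.isLt))
  intro j
  induction j with
  | zero =>
      intro z hz
      have : z = rootOf k z := funext fun ν => hz ν (Nat.zero_le _)
      rw [← this]
  | succ j ih =>
      intro z hz
      by_cases hj : j < P.d
      swap
      · exact ih z (fun ν hν => absurd (lt_of_lt_of_le ν.isLt (le_trans (not_lt.mp hj) hν)) (lt_irrefl _))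
      set μ : Fin P.d := ⟨j, hj⟩ with hμ
      -- the signed offset of `z` from its root in direction `μ`
      set t : ℤ := ((z μ).val : ℤ) - (((rootOf k z μ).val : ℕ) : ℤ) with ht
      have hb := val_rootOf_le hk z μ
      have ht₁ : -(((P.L ^ k - 1) / 2 : ℕ) : ℤ) ≤ t := by rw [ht]; omega
      have ht₂ : t ≤ (((P.L ^ k - 1) / 2 : ℕ) : ℤ) := by rw [ht]; omega
      have hhi : ∀ ν, μ < ν → z ν = rootOf k z ν := fun ν hν => hz ν (by
        have : μ.val < ν.val := hν
        simpa [hμ] using this)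
      -- `z` is the offset-`t` point, the offset-`0` point has its coordinates `≥ j` at the root
      have hzt : z = update z μ (rootOf k z μ + (t : ZMod (P.sitesPerDir 0))) := by
        have hcoord : rootOf k z μ + (t : ZMod (P.sitesPerDir 0)) = z μ := by
          rw [ht]; push_cast
          rw [ZMod.natCast_zmod_val, ZMod.natCast_zmod_val]; ring
        rw [hcoord, update_eq_self]
      have hwalk := apply_update_eq_of_combInvariant hk φ hcomb z μ hhi ht₁ ht₂
      rw [← hzt] at hwalk
      rw [hwalk]
      -- the offset-`0` point
      set z' : Site P 0 := update z μ (rootOf k z μ) with hz'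
      have hroot' : rootOf k z' = rootOf k z := by
        have h := rootOf_update_rootOf_add_eq hk z μ (t := 0) (by omega) (by omega)
        simpa [hz'] using h
      have hz'hyp : ∀ ν : Fin P.d, j ≤ ν.val → z' ν = rootOf k z' ν := by
        intro ν hν
        rw [hroot']
        by_cases hνμ : ν = μ
        · subst hνμ; simp [hz']
        · have hlt : μ < ν := by
            have hne : ν.val ≠ j := fun h => hνμ (Fin.ext (by simp [hμ, h]))
            show μ.val < ν.val
            simp only [hμ]; omega
          rw [hz', update_of_ne hνμ]
          exact hhi ν hlt
      rw [ih z' hz'hyp, hroot']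

/-- ★★★ **THE ADDITIVE `hT`-CORE**: a comb-invariant function vanishing at every `k`-block centre vanishes identically. [cite: Balaban1985RegularSpaces, (1.19) p.79 (sentence after (1.20))] -/
theorem eq_zero_of_combInvariant_of_rootOf [Zero α] (hk : k ≤ P.m + P.K) (φ : Site P 0 → α)
    (hcomb : ∀ b : PBond P 0, b ∈ (combSet k : Set (PBond P 0)) → φ b.tgt = φ b.src)
    (h0 : ∀ x : Site P 0, φ (rootOf k x) = 0) : φ = 0 := by
  funext x
  rw [apply_eq_apply_rootOf_of_combInvariant hk φ hcomb x, h0 x]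
  rfl

/-- ★★★ The same with the centres spelled `embIter k Y` (px16 g17's `hT` currency: `∀ x : Site P k, φ (embIter k x) = 0`).
[cite: Balaban1985RegularSpaces, (1.19) p.79 (sentence after (1.20))] -/
theorem eq_zero_of_combInvariant_of_embIter [Zero α] (hk : k ≤ P.m + P.K) (φ : Site P 0 → α)
    (hcomb : ∀ b : PBond P 0, b ∈ (combSet k : Set (PBond P 0)) → φ b.tgt = φ b.src)
    (h0 : ∀ Y : Site P k, φ (embIter k Y) = 0) : φ = 0 :=
  eq_zero_of_combInvariant_of_rootOf hk φ hcomb fun x => h0 (blockIter k x)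

/-- The difference form: `φ b.tgt − φ b.src = 0` on the comb and `φ = 0` at the centres ⟹ `φ = 0` (additive groups). [cite: Balaban1985RegularSpaces, (1.19) p.79] -/
theorem eq_zero_of_sub_eq_zero_on_combSet {M : Type*} [AddGroup M] (hk : k ≤ P.m + P.K) (φ : Site P 0 → M)
    (hcomb : ∀ b : PBond P 0, b ∈ (combSet k : Set (PBond P 0)) → φ b.tgt - φ b.src = 0)
    (h0 : ∀ Y : Site P k, φ (embIter k Y) = 0) : φ = 0 :=
  eq_zero_of_combInvariant_of_embIter hk φ (fun b hb => sub_eq_zero.mp (hcomb b hb)) h0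

end Summit.QuantumFields.YangMills.Theorems.FluctuationComparisonRegPrIntLS2BetaCombConnectivity

end
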